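import Summits.MatrixMultiplication.MatrixMultiplication.Theorems.AbelianSTPPCensusTB3StatDefs

/-!
# T_B static certificate, range `5216 … 5590` (t*-indexed linear checker with the k-member tree at `τ = 2375/1000`): kernel evaluation, the completeness of the bucket lists, volumes `1 … 500` (small volume chunks: the kernel recursion through the long low-`t` lists is bounded per theorem)

Cell mm-stpp (rung F-M1), tier T_B = «beat `2.375` (Coppersmith–Winograd)»; checker in `AbelianSTPPCensusTB3StatDefs.lean`, table and bucket lists in `AbelianSTPPCensusTB3StatData.lean`
(pattern: theory g12's `AbelianSTPPCensusTAStatDDom*/DCk*.lean`).  `decide` with kernel reduction (standard axioms; no `native_decide`), `Elab.async false`;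
consumed by `TB3Stat.checkV_sound` / `TB3Stat.domV_sound` / `TB3Stat.m2V_sound` in the leaf `AbelianSTPPCensusLeafTB5590Closed.lean`.
WHAT THIS IS NOT: arithmetic on shape lists only; no statement about STPP families or `ω`.
-/

set_option linter.dupNamespace false
set_option autoImplicit false
set_option Elab.async false

namespace Summit.MatrixMultiplication.MatrixMultiplication.Theorems.TB3Stat

set_option maxHeartbeats 0 in
/-- Completeness chunk: every sorted candidate shape of the volumes `1 … 50` lies in the list of the bucket of its `a·b` (132 shapes). [original] -/
theorem m2c1 : TB3Stat.m2V 50 1 = true := by decide +kernel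

set_option maxHeartbeats 0 in
/-- Completeness chunk: every sorted candidate shape of the volumes `51 … 100` lies in the list of the bucket of its `a·b` (191 shapes). [original] -/
theorem m2c51 : TB3Stat.m2V 50 51 = true := by decide +kernel

set_option maxHeartbeats 0 in
/-- Completeness chunk: every sorted candidate shape of the volumes `101 … 150` lies in the list of the bucket of its `a·b` (216 shapes). [original] -/
theorem m2c101 : TB3Stat.m2V 50 101 = true := by decide +kernel

set_option maxHeartbeats 0 in
/-- Completeness chunk: every sorted candidate shape of the volumes `151 … 200` lies in the list of the bucket of its `a·b` (239 shapes). [original] -/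
theorem m2c151 : TB3Stat.m2V 50 151 = true := by decide +kernel

set_option maxHeartbeats 0 in
/-- Completeness chunk: every sorted candidate shape of the volumes `201 … 250` lies in the list of the bucket of its `a·b` (241 shapes). [original] -/
theorem m2c201 : TB3Stat.m2V 50 201 = true := by decide +kernel

set_option maxHeartbeats 0 in
/-- Completeness chunk: every sorted candidate shape of the volumes `251 … 300` lies in the list of the bucket of its `a·b` (274 shapes). [original] -/
theorem m2c251 : TB3Stat.m2V 50 251 = true := by decide +kernel

set_option maxHeartbeats 0 in
/-- Completeness chunk: every sorted candidate shape of the volumes `301 … 350` lies in the list of the bucket of its `a·b` (264 shapes). [original] -/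
theorem m2c301 : TB3Stat.m2V 50 301 = true := by decide +kernel

set_option maxHeartbeats 0 in
/-- Completeness chunk: every sorted candidate shape of the volumes `351 … 400` lies in the list of the bucket of its `a·b` (294 shapes). [original] -/
theorem m2c351 : TB3Stat.m2V 50 351 = true := by decide +kernel

set_option maxHeartbeats 0 in
/-- Completeness chunk: every sorted candidate shape of the volumes `401 … 450` lies in the list of the bucket of its `a·b` (291 shapes). [original] -/
theorem m2c401 : TB3Stat.m2V 50 401 = true := by decide +kernel

set_option maxHeartbeats 0 in
/-- Completeness chunk: every sorted candidate shape of the volumes `451 … 500` lies in the list of the bucket of its `a·b` (286 shapes). [original] -/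
theorem m2c451 : TB3Stat.m2V 50 451 = true := by decide +kernel

end Summit.MatrixMultiplication.MatrixMultiplication.Theorems.TB3Stat
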